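import Mathlib.LinearAlgebra.Lagrange
import HarnessLib

/-!
# Venture HSemireg — a power-sum identity for Lagrange nodal weights

Seat w1-tw-1 of the computation cell `pub-hsemireg` (W1 «twisted sheaves», CC note §26.7 (G)(iii′) of
`widen/W1/CLEAN-COMPONENT-THEOREM-w1tw1.md`, machine legs TEST 4 ∕ `widen/W1/w1tw1/facetypes/face_types4.py`,
second code `widen/W1/FACETYPES4-X2-tw2.md`). There, on a hyperelliptic genus-six curve, the 8 × 8
Brill–Noether matrix `[1, w⁻¹, …, w⁻⁶, g_T]` on eight points with pairwise distinct abscissae has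
determinant `± (Vandermonde) · (D₀ + Σ μ_j Y_j)` with `μ_j = λ_j u_j⁷ ∕ (1 − w_T u_j)`, `λ_j` the Lagrange
nodal weights of the nodes `u_j = 1 ∕ w_j`, and the closed form `Σ_j μ_j = 1 ∕ ∏_j (1 − w_T u_j)` is what
makes `D₀ ≠ 0`. This file records that closed form for any number of nodes over any field, as an
instance of Lagrange interpolation (Mathlib's first barycentric form): the polynomial `X ^ (n - 1)` is
its own interpolant on `n` distinct nodes, so

* `sum_nodalWeight_mul_inv_sub_mul_pow` — for `x` off the nodes,
  `Σ_i λ_i · (x − v_i)⁻¹ · v_i ^ (n − 1) = x ^ (n − 1) · (∏_i (x − v_i))⁻¹`;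
* `sum_nodalWeight_mul_pow_mul_inv_one_sub` — for `c ≠ 0` with all `1 − c·v_i ≠ 0`,
  `Σ_i λ_i · v_i ^ (n − 1) · (1 − c·v_i)⁻¹ = (∏_i (1 − c·v_i))⁻¹` (the TEST 4 form, `x = c⁻¹`);
* `sum_nodalWeight_mul_pow` — the `c = 0` companion `Σ_i λ_i · v_i ^ (n − 1) = 1`
  (the top divided difference of `X ^ (n − 1)`).

HONEST FRAMING. Elementary algebra of Lagrange interpolation over a field; no curve, Jacobian, theta
divisor or semiregularity map appears; nothing here says that HC, HC_CM or HC_AV holds, and nothing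
here is a new case of anything.
-/

namespace Summit.Ventures.HSemireg

namespace NodalWeightPowerSum

open Polynomial Lagrange Finset

variable {F : Type*} [Field F] {ι : Type*} [DecidableEq ι] {s : Finset ι} {v : ι → F}

/-- `X ^ (#s - 1)` is its own Lagrange interpolant on the `#s` distinct nodes `v i`, `i ∈ s`. -/
theorem interpolate_pow_card_sub_one (hvs : Set.InjOn v s) (hs : s.Nonempty) :
    interpolate s v (fun i => v i ^ (#s - 1)) = (X : F[X]) ^ (#s - 1) := by
  have hdeg : ((X : F[X]) ^ (#s - 1)).degree < #s := by
    rw [degree_X_pow]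
    exact_mod_cast Nat.sub_lt hs.card_pos Nat.one_pos
  have h := eq_interpolate hvs hdeg
  simp only [eval_pow, eval_X] at h
  exact h.symm

/-- **First barycentric form applied to `X ^ (n - 1)`.** For `x` different from every node,
`∑ i ∈ s, λ_i * (x - v i)⁻¹ * v i ^ (#s - 1) = x ^ (#s - 1) * (∏ i ∈ s, (x - v i))⁻¹`,
where `λ_i = nodalWeight s v i = ∏ j ∈ s.erase i, (v i - v j)⁻¹`. -/
theorem sum_nodalWeight_mul_inv_sub_mul_pow (hvs : Set.InjOn v s) (hs : s.Nonempty) {x : F}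
    (hx : ∀ i ∈ s, x ≠ v i) :
    ∑ i ∈ s, nodalWeight s v i * (x - v i)⁻¹ * v i ^ (#s - 1)
      = x ^ (#s - 1) * (∏ i ∈ s, (x - v i))⁻¹ := by
  have h := eval_interpolate_not_at_node (fun i => v i ^ (#s - 1)) hx
  rw [interpolate_pow_card_sub_one hvs hs, eval_pow, eval_X, eval_nodal] at h
  have hprod : ∏ i ∈ s, (x - v i) ≠ 0 :=
    prod_ne_zero_iff.mpr fun i hi => sub_ne_zero_of_ne (hx i hi)
  rw [eq_mul_inv_iff_mul_eq₀ hprod, h, mul_comm]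

/-- **The TEST 4 closed form.** For `c ≠ 0` with `1 - c * v i ≠ 0` for all nodes,
`∑ i ∈ s, λ_i * v i ^ (#s - 1) * (1 - c * v i)⁻¹ = (∏ i ∈ s, (1 - c * v i))⁻¹`
(the previous identity at `x = c⁻¹`, cleared of the powers of `c`). -/
theorem sum_nodalWeight_mul_pow_mul_inv_one_sub (hvs : Set.InjOn v s) (hs : s.Nonempty) {c : F}
    (hc : c ≠ 0) (hcv : ∀ i ∈ s, 1 - c * v i ≠ 0) :
    ∑ i ∈ s, nodalWeight s v i * v i ^ (#s - 1) * (1 - c * v i)⁻¹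
      = (∏ i ∈ s, (1 - c * v i))⁻¹ := by
  -- the previous identity at x = c⁻¹
  have hx : ∀ i ∈ s, c⁻¹ ≠ v i := by
    intro i hi h
    apply hcv i hi
    rw [← h, mul_inv_cancel₀ hc, sub_self]
  have hA := sum_nodalWeight_mul_inv_sub_mul_pow hvs hs hx
  have hfac : ∀ i, c⁻¹ - v i = c⁻¹ * (1 - c * v i) := by
    intro i
    rw [mul_sub, mul_one, ← mul_assoc, inv_mul_cancel₀ hc, one_mul]
  have hsum : ∑ i ∈ s, nodalWeight s v i * (c⁻¹ - v i)⁻¹ * v i ^ (#s - 1)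
      = c * ∑ i ∈ s, nodalWeight s v i * v i ^ (#s - 1) * (1 - c * v i)⁻¹ := by
    rw [mul_sum]
    refine sum_congr rfl fun i _ => ?_
    rw [hfac i, mul_inv, inv_inv]
    ring
  have hprod : ∏ i ∈ s, (c⁻¹ - v i) = (c⁻¹) ^ #s * ∏ i ∈ s, (1 - c * v i) := by
    rw [← prod_const, ← prod_mul_distrib]
    exact prod_congr rfl fun i _ => hfac i
  rw [hsum, hprod] at hA
  obtain ⟨n, hn⟩ : ∃ n, #s = n + 1 := ⟨#s - 1, (Nat.sub_add_cancel hs.card_pos).symm⟩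
  rw [hn, Nat.add_sub_cancel] at hA ⊢
  -- hA : c * S = c⁻¹ ^ n * (c⁻¹ ^ (n + 1) * P)⁻¹ ; goal : S = P⁻¹
  apply mul_left_cancel₀ hc
  rw [hA, mul_inv, ← mul_assoc]
  congr 1
  rw [inv_pow, inv_pow, inv_inv, pow_succ, ← mul_assoc, inv_mul_cancel₀ (pow_ne_zero n hc), one_mul]

/-- **The `c = 0` companion** (top divided difference of `X ^ (n - 1)`):
`∑ i ∈ s, λ_i * v i ^ (#s - 1) = 1`. -/
theorem sum_nodalWeight_mul_pow (hvs : Set.InjOn v s) (hs : s.Nonempty) :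
    ∑ i ∈ s, nodalWeight s v i * v i ^ (#s - 1) = 1 := by
  have hdeg : ((X : F[X]) ^ (#s - 1)).degree < #s := by
    rw [degree_X_pow]
    exact_mod_cast Nat.sub_lt hs.card_pos Nat.one_pos
  have h := coeff_eq_sum hvs hdeg
  rw [coeff_X_pow, if_pos rfl] at h
  rw [h]
  refine sum_congr rfl fun i _ => ?_
  rw [eval_pow, eval_X, nodalWeight, div_eq_mul_inv, mul_comm, prod_inv_distrib]

end NodalWeightPowerSum

end Summit.Ventures.HSemireg
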